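import Summits.Ventures.PercRepro.Night2OneFatCaseOneAssemblyC

/-!
# PercRepro — the case-1 assembly, part D: small bridges (night-2, gen 29)

The remaining bridges of §4⁗ before the final theorem: the permutation lemmas of `typeCount` / `ClosureProp`, the faces
`(S ∖ y_b) ∖ y_c` are symmetric in `b, c`, `y_a ∉ cl ((S ∖ y_a) ∖ y_c)`, the vanishing of `gtLoadAt` without a lossy face,
and its value at a good source.
-/

namespace PercRepro.Shadow

open Finset PerFlat ThmH

variable {α : Type*} [DecidableEq α]

section Perm

variable {X : Finset α} {H A₁ A₂ A₃ : α → Prop} [DecidablePred H] [DecidablePred A₁] [DecidablePred A₂] [DecidablePred A₃]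

omit [DecidableEq α] in
/-- Swapping the first two predicates permutes the type counts. -/
theorem typeCount_swap12 (h a b c : Bool) :
    typeCount X H A₂ A₁ A₃ h a b c = typeCount X H A₁ A₂ A₃ h b a c := by
  unfold typeCount
  congr 1
  ext x
  simp only [Finset.mem_filter]
  tauto

omit [DecidableEq α] in
/-- Swapping the first and third predicates permutes the type counts. -/
theorem typeCount_swap13 (h a b c : Bool) :
    typeCount X H A₃ A₂ A₁ h a b c = typeCount X H A₁ A₂ A₃ h c b a := by
  unfold typeCount
  congr 1
  ext x
  simp only [Finset.mem_filter]
  tauto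

omit [DecidableEq α] [DecidablePred A₁] [DecidablePred A₂] [DecidablePred A₃] in
/-- The closure property is symmetric. -/
theorem ClosureProp.swap12 (hP : ClosureProp A₁ A₂ A₃) : ClosureProp A₂ A₁ A₃ :=
  ⟨hP.2.1, hP.1, fun x h2 h1 => hP.2.2 x h1 h2⟩

omit [DecidableEq α] [DecidablePred A₁] [DecidablePred A₂] [DecidablePred A₃] in
/-- The closure property is symmetric. -/
theorem ClosureProp.swap13 (hP : ClosureProp A₁ A₂ A₃) : ClosureProp A₃ A₂ A₁ :=
  ⟨fun x h2 h1 => hP.2.2 x h1 h2, fun x h3 h1 => hP.2.1 x h1 h3, fun x h3 h2 => hP.1 x h2 h3⟩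

end Perm

variable {M : Matroid α} [M.Finite] {G : Finset α}

section Bridges

/-- `gtLoadAt` vanishes when no face of `Q` loses. -/
theorem gtLoadAt_eq_zero_of_faceLossP_eq_zero (P : Finset α → Prop) [DecidablePred P] {Q : Finset α}
    (h : ∀ w ∈ Q, faceLossP M 5 G P Q w = 0) (y : α) : gtLoadAt M 5 G P Q y = 0 := by
  unfold gtLoadAt
  have hsum : ∑ w ∈ Q, faceLossP M 5 G P Q w = 0 := Finset.sum_eq_zero h
  split_ifs
  · rw [hsum, zero_div]
  · rfl
  · apply Finset.sum_eq_zero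
    intro w hw
    rw [h w hw]
    simp

/-- `gtLoadAt` at a good point of `Q`. -/
theorem gtLoadAt_of_mem_gtPts (P : Finset α → Prop) [DecidablePred P] {Q : Finset α} {y : α}
    (hy : y ∈ gtPts M 5 G Q) :
    gtLoadAt M 5 G P Q y = (∑ w ∈ Q, faceLossP M 5 G P Q w) / ((gtPts M 5 G Q).card : ℚ) := by
  unfold gtLoadAt
  rw [if_pos ⟨y, hy⟩, if_pos hy]

/-- `gtLoadAt` is nonnegative. -/
theorem gtLoadAt_nonneg (hG : G ∈ flatsQ M (5 + 1)) (hd : (gr M \ G).card ≤ 5) (P : Finset α → Prop)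
    [DecidablePred P] (Q : Finset α) (y : α) : 0 ≤ gtLoadAt M 5 G P Q y := by
  unfold gtLoadAt
  have hnn : 0 ≤ ∑ w ∈ Q, faceLossP M 5 G P Q w := Finset.sum_nonneg (fun w _ => faceLossP_nonneg hG hd Q w)
  split_ifs
  · positivity
  · exact le_refl _
  · apply Finset.sum_nonneg
    intro w _
    split_ifs
    · exact faceLossP_nonneg hG hd Q w
    · exact le_refl _

/-- The faces `(S ∖ y_b) ∖ y_c` are symmetric in `b, c`. -/
theorem erase_erase_comm (S : Finset α) (a b : α) : (S.erase a).erase b = (S.erase b).erase a :=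
  Finset.erase_right_comm

/-- **`y₁ ∉ cl ((S ∖ y₁) ∖ y₂)`** (Claim B lifted through `K`): `y₁, y₂ ∈ S ∖ K` not coloops of `S ∖ K` (rank `5`), `y₂` a coloop of
`(S ∖ K) ∖ y₁`. -/
theorem notMem_clF_face_pair (hG : G ∈ flatsQ M (5 + 1)) (hk : kColoops M G = 1) {S : Finset α} (hSG : S ⊆ G)
    (hKS : coloops M G ⊆ S) (hS5 : rkN M (S \ coloops M G) = 5) {y₁ y₂ : α} (hy₁ : y₁ ∈ S \ coloops M G)
    (hy₂ : y₂ ∈ S \ coloops M G) (hc₁ : y₁ ∉ coloops M (S \ coloops M G))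
    (hc₂ : y₂ ∉ coloops M (S \ coloops M G)) (hcol₂ : y₂ ∈ coloops M ((S \ coloops M G).erase y₁)) :
    y₁ ∉ clF M ((S.erase y₁).erase y₂) := by
  have hGg : G ⊆ gr M := (mem_flatsQ.1 hG).1
  have hVg : S \ coloops M G ⊆ gr M := Finset.sdiff_subset.trans (hSG.trans hGg)
  have hcard1 : (coloops M G).card = 1 := by rw [← kColoops_eq_card_coloops (M := M) G]; exact hk
  obtain ⟨e₀, he₀⟩ := Finset.card_eq_one.1 hcard1
  have he₀c : e₀ ∈ coloops M G := by rw [he₀]; exact Finset.mem_singleton_self _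
  have he₀S : e₀ ∈ S := hKS he₀c
  have heq : (S.erase y₁).erase y₂ = insert e₀ (((S \ coloops M G).erase y₁).erase y₂) := by
    ext a
    simp only [Finset.mem_erase, Finset.mem_insert, Finset.mem_sdiff, he₀, Finset.mem_singleton]
    constructor
    · rintro ⟨ha2, ha1, haS⟩
      by_cases hae : a = e₀
      · exact Or.inl hae
      · exact Or.inr ⟨ha2, ha1, haS, hae⟩
    · rintro (rfl | ⟨ha2, ha1, haS, -⟩)
      · exact ⟨fun h => (Finset.mem_sdiff.1 hy₂).2 (h ▸ he₀c), fun h => (Finset.mem_sdiff.1 hy₁).2 (h ▸ he₀c), he₀S⟩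
      · exact ⟨ha2, ha1, haS⟩
  have hy₁5 : rkN M ((S \ coloops M G).erase y₁) = 5 := by rw [rkN_erase_of_not_coloop hVg hy₁ hc₁, hS5]
  intro hcl
  rw [heq] at hcl
  have := mem_clF_sdiff_coloops_of_mem_clF_insert hG he₀ (((Finset.erase_subset _ _).trans
    (Finset.erase_subset _ _)).trans (Finset.sdiff_subset_sdiff hSG (Finset.Subset.refl _)))
    (Finset.sdiff_subset_sdiff hSG (Finset.Subset.refl _) hy₁) hcl
  exact notMem_clF_face_of_not_coloop hVg hS5 hy₁ hy₁5 hcol₂ hc₂ this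

/-- A request equal to `Φ/(m + 2)` or to `0` is admissible for `m`. -/
theorem admissible_of_eq_req {m : ℕ} {r : ℚ} (h : r = phiQ 5 / ((m : ℚ) + 2) ∨ r = 0) : AdmissibleReq m r := by
  rcases h with rfl | rfl
  · refine ⟨?_, ?_, ?_⟩
    · exact div_nonneg (by unfold phiQ; norm_num) (by positivity)
    · intro h2; right; rw [h2]; unfold phiQ; norm_num
    · intro h3
      unfold phiQ
      have h3' : (3 : ℚ) ≤ (m : ℚ) := by exact_mod_cast h3
      rw [div_le_div_iff₀ (by linarith) (by norm_num)]
      linarith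
  · exact ⟨le_refl _, fun _ => Or.inl rfl, fun _ => by norm_num⟩

end Bridges

end PercRepro.Shadow
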